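import Summits.QuantumFields.YangMills.Theorems.BalabanLadderUVSeamRecColdWallDeficitThreeQuarters
import Summits.QuantumFields.YangMills.Theorems.WeakCouplingRatesBulkDominatesColdBoxWStubKernelMeanExpansion
import Summits.QuantumFields.YangMills.Theorems.WeakCouplingRatesBulkDominatesColdBoxWStubDlrAssembly
import Summits.QuantumFields.YangMills.Theorems.WeakCouplingRatesLargeFieldTailAllSides
import Summits.QuantumFields.YangMills.Theorems.BalabanLadderUVSeamRecColdWallSplitCrudeGood
import Literature.MathematicalPhysics.QuantumFieldTheory.WilsonAxisSymmetry
import HarnessLib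

/-!
# Crux `UVSeamRec` (stmt-QuantumFields-20043), line «coldwall_pure»: THE ONE-LOOP FLOOR OF THE TORUS PLAQUETTE, UNIFORM IN THE VOLUME —
# `β·⟨2 − Re tr U_p⟩_{torus, β} ≥ 3/4 − 3β^{−θ}` for all large tori, and COLD-WALL EXTREMALITY AT ONE LOOP for crude-good exteriors

Helper file (`--supports stmt-QuantumFields-20043`) of the LEAD seat `ym-spine-20043-p1` (gen 15).  The route `WeakCouplingRates`' registered
theorem `stub_kernelMeanExpansion` says that for every CRUDE-GOOD datum `ω` of the cold box `H = ⌈β^θ⌉` the kernel mean of the plaquette cost near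
the centre is `β·E_ω[c_x] = (3/2)V_D(x) + β·Σ_c F̄_c(x)² ± β^{−θ}` with a NON-NEGATIVE classical (background) term.  Two consequences:
* §1 **`kernelMean_ge_of_crudeGood`** — `β·E_ω[c_x] ≥ (3/2)V_D(x) − β^{−θ}` for every crude-good `ω`; with the flat-datum expansion of gen 14
  (`coldWall_kernelMean_sub_le`) this is **COLD-WALL EXTREMALITY AT ONE LOOP** (`kernelMean_one_le_kernelMean_add_of_crudeGood`):
  `E_𝟙[c_x] ≤ E_ω[c_x] + 2β^{−1−θ}` — among crude-good exteriors the cold wall MINIMISES the centre deficit up to `o(1/β)` (the sign bet of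
  the sibling line «extremal_coldwall» (CWX, ym-idea-10), verified at one loop on the top scale; gen 12: CWX ⇒ Tier 3).
* §2 **`torus_plaqCost_ge_oneLoop`** / **`torus_plaqCost_ge_threeQuarters`** — THE TORUS: by the DLR equations of the torus Wilson state for the
  box (`wilsonExpectation_toTorusObservable_eq`), translation invariance, the route's volume-uniform large-field rarity (`plaquetteLargeFieldRarity_eventually`,
  chessboard) making the lifted torus configuration a crude-good datum off an event of mass `≤ 6(2H+3)⁴e^{−β^{θ/5}}` (`measureReal_badSet_le`), and
  `V_D(centre) = 1/2 + O(H⁻⁴)` (`pow_four_mul_abs_boxDirProjKernel_centre_sub_half_le`): for `0 < θ ≤ θ₀` there is `β₀` with, for all `β ≥ β₀`,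
  eventually in the torus side, for every site `x`:  **`β·∫ plaqCostAt x 1 2 ∘ lift dμ_{(L+1)⁴,β} ≥ 3/4 − 3β^{−θ}`** — the SHARP one-loop FLOOR of
  the plaquette expectation, uniform in the volume (tree before: `6/(24β+3) ≈ 1/(4β)`, one-link, gen 10; ceiling `27/β + 2 log β/(Mβ)`, gen 11; the
  matching sharp ceiling `3/4 + o(1)` needs the torus state's classical response at the centre — the route's BULK stub — and is NOT claimed).
  `torus_plaqCost_ge_threeQuarters`: every plane (hypercubic invariance of the torus state, `integral_comp_configPerm_wilsonMeasure`).
* §3 crux letters: **`torusE_two_sub_plane_ge_threeQuarters`** — `3/4 − 3β^{−θ} ≤ β·torusE_{β,L}(2 − plane q x)` on the odd tori `(ℤ/(2L+1))⁴`,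
  every plane `q.1 < q.2`, every site, eventually in `L`.
HONEST FRAMING: a floor; the (RM)/(DR) reference of the line is thereby pinned from below at the perturbative `2 − 3/(4β) + o(1/β)` only through
the torus side; nothing of E0′, NT or the gap; YM mass gap NOT proved; not Clay.
-/

set_option autoImplicit false

noncomputable section

open MeasureTheory Finset Filter Topology
open Literature.Probability.LatticeModels (Site Torus.proj box mem_box)
open Literature.MathematicalPhysics.QuantumLattice (LGConfig ZdEdge ZdPlaquette plaquettesTouching plaquetteEdges plaquetteObs fundamentalRep
  fundamentalLatticeRep wilsonBoundaryAction ymSpecification torusLift toTorusObservable IsCylinder configShift plaquetteHolonomyZd_configShift_add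
  continuous_fundamentalRep integral_comp_configShift_torusLift wilsonExpectation_toTorusObservable_eq integrable_of_bound
  continuous_integral_ymSpecification abs_integral_ymSpecification_le)
open Literature.MathematicalPhysics.QuantumFieldTheory (wilsonMeasure wilsonExpectation GaugeConfig isProbabilityMeasure_wilsonMeasure
  measurable_torusLift configPerm configPermZd configPermZd_torusLift integral_comp_configPerm_wilsonMeasure plaquetteObs_configPermZd sitePermZd)
open Literature.MathematicalPhysics.QuantumFieldTheory.LatticeMaxwell
open Literature.MathematicalPhysics.QuantumFieldTheory.AxialGauge
open Summit.QuantumFields.YangMills.Theorems.WeakCouplingRates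
open Summit.QuantumFields.YangMills.Cruxes.OSLegsFromFemtoAndGap.DlrCollarTransfer (cubeSites cubeEdges kerE plane torusE)

namespace Summit.QuantumFields.YangMills.Cruxes.UVSeamRec.ClassicalResponse.ColdWall

/-! ### §1 The lower half of the expansion: crude-good exteriors only RAISE the one-loop deficit -/

/-- **The kernel mean under a crude-good exterior is at least the cold-wall one-loop value.**  There is `θ₀ ∈ (0, 1/100]` such that for all
`0 < θ ≤ θ₀`, eventually in `β`, with `H = ⌈β^θ⌉`: for every crude-good datum `ω` and every base point `x` within `H/8` of the centre,
`(3/2)·V_D(x;1,2) − β^{−θ} ≤ β·E_{γ_H(·|ω)}[c_{x;1,2}]` (the background term `β·Σ_c F̄_c(x)²` of `stub_kernelMeanExpansion` is non-negative). [folklore] -/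
theorem kernelMean_ge_of_crudeGood :
    ∃ θ₀ : ℝ, 0 < θ₀ ∧ θ₀ ≤ 1 / 100 ∧ ∀ θ : ℝ, 0 < θ → θ ≤ θ₀ → ∃ β₀ : ℝ, ∀ β : ℝ, β₀ ≤ β →
      ∀ ω : LGConfig 4 (Matrix.specialUnitaryGroup (Fin 2) ℂ), CrudeGood β (θ / 5) ⌈β ^ θ⌉₊ ω →
        ∀ x : Site 4, (∀ m : Fin 4, 8 * |x m - (⌈β ^ θ⌉₊ : ℤ)| ≤ (⌈β ^ θ⌉₊ : ℤ)) →
          3 / 2 * boxDirProjKernel ⌈β ^ θ⌉₊ (x, 1, 2) (x, 1, 2) - β ^ (-θ) ≤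
            β * ∫ U, plaqCostAt (fundamentalRep (Fin 2)) x 1 2 U ∂(boxKernel β ⌈β ^ θ⌉₊ ω) := by
  obtain ⟨θ₂, hθ₂, hK⟩ := stub_kernelMeanExpansion
  refine ⟨min θ₂ (1 / 100), lt_min hθ₂ (by norm_num), min_le_right _ _, fun θ hθ hθle => ?_⟩
  obtain ⟨β₀, hKME⟩ := hK θ hθ (hθle.trans (min_le_left _ _))
  refine ⟨max β₀ 0, fun β hβ ω hω x hx => ?_⟩
  obtain ⟨ϑ, s, -, hexp⟩ := hKME β ((le_max_left _ _).trans hβ) ω hω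
  have h := (abs_le.1 (hexp x hx)).1
  have hB : 0 ≤ β * ∑ c, (sCirc (glue (pin := fun e => e ∉ dirFreeEdges ⌈β ^ θ⌉₊) dirCorner (2 * ⌈β ^ θ⌉₊ + 3) (ϑ c)
      (mean (fun e => e ∉ dirFreeEdges ⌈β ^ θ⌉₊) dirCorner (2 * ⌈β ^ θ⌉₊ + 3) (ϑ c))) (x, 1, 2)) ^ 2 :=
    mul_nonneg ((le_max_right _ _).trans hβ) (Finset.sum_nonneg fun c _ => sq_nonneg _)
  linarith

/-- **COLD-WALL EXTREMALITY AT ONE LOOP (top scale).**  There is `θ₀ ∈ (0, 1/100]` such that for all `0 < θ ≤ θ₀`, eventually in `β`, with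
`H = ⌈β^θ⌉`: for every crude-good datum `ω` and every base point `x` within `H/8` of the centre,
`E_{γ_H(·|𝟙)}[c_{x;1,2}] ≤ E_{γ_H(·|ω)}[c_{x;1,2}] + 2β^{−1−θ}` — the cold wall minimises the one-loop deficit among crude-good exteriors
(gen 14's flat-datum expansion `coldWall_kernelMean_sub_le` for the upper bound at `𝟙`, §1 for the lower bound at `ω`). [folklore] -/
theorem kernelMean_one_le_kernelMean_add_of_crudeGood :
    ∃ θ₀ : ℝ, 0 < θ₀ ∧ θ₀ ≤ 1 / 100 ∧ ∀ θ : ℝ, 0 < θ → θ ≤ θ₀ → ∃ β₀ : ℝ, ∀ β : ℝ, β₀ ≤ β →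
      ∀ ω : LGConfig 4 (Matrix.specialUnitaryGroup (Fin 2) ℂ), CrudeGood β (θ / 5) ⌈β ^ θ⌉₊ ω →
        ∀ x : Site 4, (∀ m : Fin 4, 8 * |x m - (⌈β ^ θ⌉₊ : ℤ)| ≤ (⌈β ^ θ⌉₊ : ℤ)) →
          ∫ U, plaqCostAt (fundamentalRep (Fin 2)) x 1 2 U ∂(boxState (fundamentalRep (Fin 2)) β ⌈β ^ θ⌉₊) ≤
            (∫ U, plaqCostAt (fundamentalRep (Fin 2)) x 1 2 U ∂(boxKernel β ⌈β ^ θ⌉₊ ω)) + 2 * β ^ (-1 - θ) := by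
  obtain ⟨θ₀, hθ₀, hθ₀', hA⟩ := kernelMean_ge_of_crudeGood
  refine ⟨θ₀, hθ₀, hθ₀', fun θ hθ hθle => ?_⟩
  obtain ⟨β₁, hβ₁⟩ := hA θ hθ hθle
  obtain ⟨β₂, hβ₂⟩ := coldWall_kernelMean_sub_le hθ (hθle.trans hθ₀')
  refine ⟨max (max β₁ β₂) 1, fun β hβ ω hω x hx => ?_⟩
  have hb1 : β₁ ≤ β := ((le_max_left _ _).trans (le_max_left _ _)).trans hβ
  have hb2 : β₂ ≤ β := ((le_max_right _ _).trans (le_max_left _ _)).trans hβ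
  have hβ1 : (1 : ℝ) ≤ β := (le_max_right _ _).trans hβ
  have hβ0 : 0 < β := by linarith
  have hH : 1 ≤ ⌈β ^ θ⌉₊ := by have h := (one_le_ceil_rpow_and_le hβ1 hθ.le).1; exact_mod_cast h
  have hxt := near_centre_mem_plaquettesTouching hH hx
  have hlow := hβ₁ β hb1 ω hω x hx
  have hup := (abs_le.1 (hβ₂ β hb2 ⌈β ^ θ⌉₊ hH le_rfl x 1 2 (by decide) hxt)).2
  have hβθ : β ^ (-1 - θ) = β ^ (-θ) / β := by rw [show -1 - θ = -θ - 1 by ring, Real.rpow_sub_one hβ0.ne']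
  generalize hVdef : boxDirProjKernel ⌈β ^ θ⌉₊ (x, 1, 2) (x, 1, 2) = V at hlow hup
  generalize hIdef : ∫ U, plaqCostAt (fundamentalRep (Fin 2)) x 1 2 U ∂(boxState (fundamentalRep (Fin 2)) β ⌈β ^ θ⌉₊) = I at hup ⊢
  generalize hJdef : ∫ U, plaqCostAt (fundamentalRep (Fin 2)) x 1 2 U ∂(boxKernel β ⌈β ^ θ⌉₊ ω) = J at hlow ⊢
  rw [hβθ, show J + 2 * (β ^ (-θ) / β) = (β * J + 2 * β ^ (-θ)) / β by field_simp, le_div_iff₀ hβ0]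
  linarith

/-! ### §2 The torus: the one-loop floor of the plaquette, uniform in the volume -/

/-- **THE TORUS PLAQUETTE IS AT LEAST THE COLD-WALL ONE-LOOP VALUE** (route letters).  There is `θ₀ ∈ (0, 1/100]` such that for all `0 < θ ≤ θ₀`
there is `β₀` with: for all `β ≥ β₀`, eventually in the torus side `L + 1`, for every site `x`,
`β·∫ c_{x;1,2} ∘ lift dμ_{(L+1)⁴,β} ≥ (3/2)·V_{D,H}(centre;1,2) − β^{−θ} − 9(2H+3)⁴e^{−β^{θ/5}}`, `H = ⌈β^θ⌉` — translation invariance of the torus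
state, its DLR equations for the box kernel, the lower half of the expansion (§1) off the bad boundary data, and their chessboard rarity. [folklore] -/
theorem torus_plaqCost_ge_oneLoop :
    ∃ θ₀ : ℝ, 0 < θ₀ ∧ θ₀ ≤ 1 / 100 ∧ ∀ θ : ℝ, 0 < θ → θ ≤ θ₀ → ∃ β₀ : ℝ, ∀ β : ℝ, β₀ ≤ β → ∀ᶠ L : ℕ in atTop, ∀ x : Site 4,
      3 / 2 * boxDirProjKernel ⌈β ^ θ⌉₊ (boxCentre ⌈β ^ θ⌉₊, 1, 2) (boxCentre ⌈β ^ θ⌉₊, 1, 2) - β ^ (-θ) -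
          9 * (2 * (⌈β ^ θ⌉₊ : ℝ) + 3) ^ 4 * Real.exp (-(β ^ (θ / 5))) ≤
        β * ∫ U, plaqCostAt (fundamentalRep (Fin 2)) x 1 2 (torusLift (L + 1) U)
          ∂(wilsonMeasure (d := 4) (L := L + 1) (fundamentalRep (Fin 2)) β) := by
  obtain ⟨θ₀, hθ₀, hθ₀', hA⟩ := kernelMean_ge_of_crudeGood
  refine ⟨θ₀, hθ₀, hθ₀', fun θ hθ hθle => ?_⟩
  obtain ⟨β₁, hβ₁⟩ := hA θ hθ hθle
  have hδ : (0 : ℝ) < θ / 5 := by positivity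
  obtain ⟨β₂, hβ₂⟩ := plaquetteLargeFieldRarity_eventually hδ
  refine ⟨max (max β₁ β₂) 1, fun β hβ => ?_⟩
  have hb1 : β₁ ≤ β := ((le_max_left _ _).trans (le_max_left _ _)).trans hβ
  have hb2 : β₂ ≤ β := ((le_max_right _ _).trans (le_max_left _ _)).trans hβ
  have hβ1 : (1 : ℝ) ≤ β := (le_max_right _ _).trans hβ
  have hβ0 : 0 < β := by linarith
  set H : ℕ := ⌈β ^ θ⌉₊ with hHdef
  have hH : 1 ≤ H := by have h := (one_le_ceil_rpow_and_le hβ1 hθ.le).1; rw [← hHdef] at h; exact_mod_cast h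
  filter_upwards [hβ₂ β hb2, eventually_gt_atTop (2 * (2 * H + 0 + 2))] with L hL2 hLbig x
  haveI : SecondCountableTopology (Matrix.specialUnitaryGroup (Fin 2) ℂ) := secondCountableTopology_su2
  set ρ : (Matrix.specialUnitaryGroup (Fin 2) ℂ) →* Matrix (Fin 2) (Fin 2) ℂ := fundamentalRep (Fin 2) with hρdef
  have hρc : Continuous ρ := continuous_fundamentalRep (Fin 2)
  haveI := isProbabilityMeasure_wilsonMeasure (d := 4) (L := L + 1) (G := (Matrix.specialUnitaryGroup (Fin 2) ℂ)) ρ hρc β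
  set μ := wilsonMeasure (d := 4) (L := L + 1) ρ β with hμ
  set bc : Site 4 := boxCentre H with hbc
  set Λ : Finset (ZdEdge 4) := boxEdges 4 (2 * H + 1) with hΛ
  set cp : LGConfig 4 (Matrix.specialUnitaryGroup (Fin 2) ℂ) → ℝ := plaqCostAt ρ bc 1 2 with hcp
  have hcpc : Continuous cp := continuous_plaqCostAt bc 1 2
  have hcpK : ∀ U, |cp U| ≤ 4 := abs_plaqCostAt_le bc 1 2
  -- (1) translation invariance: move the plaquette to the box centre
  have hpt : ∀ W : LGConfig 4 (Matrix.specialUnitaryGroup (Fin 2) ℂ), cp (configShift (bc - x) W) = plaqCostAt ρ x 1 2 W := fun W => by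
    have h := plaquetteHolonomyZd_configShift_add (bc - x) W x 1 2
    rw [add_sub_cancel] at h
    simp only [hcp, plaqCostAt, plaquetteObs, h]
  have htr : ∫ U, plaqCostAt ρ x 1 2 (torusLift (L + 1) U) ∂μ = ∫ U, cp (torusLift (L + 1) U) ∂μ := by
    have h := integral_comp_configShift_torusLift (S := L + 1) ρ β cp (bc - x)
    simp only [hpt] at h
    exact h
  -- (2) the DLR equations of the torus state for the box
  set S₀ : Finset (ZdEdge 4) := plaquetteEdges ((bc, ⟨(1, 2), by decide⟩) : ZdPlaquette 4) ∪
      plaquetteEdges ((bc + Pi.single 0 ((0 : ℕ) : ℤ), ⟨(1, 2), by decide⟩) : ZdPlaquette 4) with hS₀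
  have hcyl : IsCylinder cp S₀ := (isCylinder_plaqCostAt12 bc).mono (Finset.coe_subset.2 Finset.subset_union_left)
  have hinj : Set.InjOn (Torus.proj (L + 1))
      ((Λ ∪ S₀ ∪ (plaquettesTouching Λ).biUnion plaquetteEdges).image Prod.fst : Set (Site 4)) := by
    intro y hy y' hy' hyy
    obtain ⟨e, he, rfl⟩ := Finset.mem_image.1 (Finset.mem_coe.1 hy)
    obtain ⟨e', he', rfl⟩ := Finset.mem_image.1 (Finset.mem_coe.1 hy')
    exact Literature.Probability.LatticeModels.torusProj_injOn_box (Nat.lt_succ_of_lt hLbig) (fst_mem_box_of_mem_boxUnion (H := H) (T := 0) he)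
      (fst_mem_box_of_mem_boxUnion (H := H) (T := 0) he') hyy
  set g : GaugeConfig 4 (L + 1) (Matrix.specialUnitaryGroup (Fin 2) ℂ) → ℝ :=
    fun U => ∫ W, cp W ∂(ymSpecification ρ β Λ (torusLift (L + 1) U)) with hg
  have hdlr : ∫ U, cp (torusLift (L + 1) U) ∂μ = ∫ U, g U ∂μ := by
    have h := wilsonExpectation_toTorusObservable_eq ρ hρc β Λ hcpc hcpK hcyl (L := L + 1) hinj
    simpa only [wilsonExpectation, toTorusObservable, Function.comp_def] using h
  -- (3) the kernel mean: non-negative everywhere, at least the one-loop value off the bad data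
  have hml := measurable_torusLift (d := 4) (G := (Matrix.specialUnitaryGroup (Fin 2) ℂ)) (L + 1)
  have hgm : Measurable g := (continuous_integral_ymSpecification ρ hρc β Λ hcpc hcpK).measurable.comp hml
  have hgK : ∀ U, |g U| ≤ 4 := fun U => abs_integral_ymSpecification_le ρ hρc β Λ hcpK _
  have hg0 : ∀ U, 0 ≤ g U := fun U => integral_nonneg fun W => plaqCostAt_nonneg bc 1 2 W
  set E : Set (GaugeConfig 4 (L + 1) (Matrix.specialUnitaryGroup (Fin 2) ℂ)) := {U | torusLift (L + 1) U ∈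
      ⋃ z ∈ (Fintype.piFinset fun _ : Fin 4 => Finset.Icc (-1 : ℤ) (2 * (H : ℤ) + 1)) ×ˢ
          ((Finset.univ : Finset (Fin 4 × Fin 4)).filter fun q => q.1 < q.2),
        {W : LGConfig 4 (Matrix.specialUnitaryGroup (Fin 2) ℂ) | β ^ (2 * (θ / 5) - 1) < plaqCostAt (fundamentalRep (Fin 2)) z.1 z.2.1 z.2.2 W}}
    with hE
  have hEm : MeasurableSet E := hml (measurableSet_badSet β (θ / 5) H)
  have hgood : ∀ U, U ∉ E → CrudeGood β (θ / 5) H (torusLift (L + 1) U) := fun U hU => crudeGood_of_not_mem_badSet hU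
  set p : ℝ := ((6 * (2 * H + 3) ^ 4 : ℕ) : ℝ) * Real.exp (-(β ^ (θ / 5))) with hp
  have hμE : μ.real E ≤ p := measureReal_badSet_le hL2
  have hp0 : 0 ≤ p := by positivity
  have hcentre : ∀ m : Fin 4, 8 * |bc m - (H : ℤ)| ≤ (H : ℤ) := fun m => by
    simp only [hbc, boxCentre, sub_self, abs_zero, mul_zero]; positivity
  -- keep the matrix inverse behind `boxDirProjKernel` away from `set`/`simp`: name the one-loop value without substitution
  obtain ⟨V, hVdef⟩ : ∃ V : ℝ, boxDirProjKernel H (bc, 1, 2) (bc, 1, 2) = V := ⟨_, rfl⟩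
  obtain ⟨v, hv⟩ : ∃ v : ℝ, v = (3 / 2 * V - β ^ (-θ)) / β := ⟨_, rfl⟩
  rw [hVdef]
  have hv_le : ∀ U, U ∉ E → v ≤ g U := fun U hU => by
    have h : 3 / 2 * boxDirProjKernel H (bc, 1, 2) (bc, 1, 2) - β ^ (-θ) ≤ β * g U := hβ₁ β hb1 _ (hgood U hU) bc hcentre
    rw [hVdef] at h
    rw [hv, div_le_iff₀ hβ0]
    linarith
  -- (4) integrate: `∫ g ≥ v · μ(Eᶜ)` when `v ≥ 0`
  have hVle : V ≤ 1 := by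
    have hxt := near_centre_mem_plaquettesTouching hH hcentre
    have hq := unshift_mem_plaquettesIn hxt
    have h := boxDirProjKernel_le_one_of_mem (H := H) hq hq
    have hs : Literature.MathematicalPhysics.QuantumFieldTheory.Plaq.shift dirCorner
        ((bc - dirCorner, (1 : Fin 4), (2 : Fin 4)) : Literature.MathematicalPhysics.QuantumFieldTheory.Plaq 4) = (bc, 1, 2) := by
      simp [Literature.MathematicalPhysics.QuantumFieldTheory.Plaq.shift]
    rw [← hVdef]
    simpa only [hs] using h
  rw [htr, hdlr]
  by_cases hv0 : 0 ≤ v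
  · have hind : ∀ U, v * Eᶜ.indicator (fun _ => (1 : ℝ)) U ≤ g U := fun U => by
      by_cases hU : U ∈ E
      · rw [Set.indicator_of_notMem (by simpa using hU), mul_zero]; exact hg0 U
      · rw [Set.indicator_of_mem (by simpa using hU), mul_one]; exact hv_le U hU
    have hgi : Integrable g μ := integrable_of_bound hgm.aestronglyMeasurable hgK
    have hint : v * μ.real Eᶜ ≤ ∫ U, g U ∂μ := by
      have h1 : ∫ U, v * Eᶜ.indicator (fun _ => (1 : ℝ)) U ∂μ = v * μ.real Eᶜ := by
        rw [integral_const_mul, integral_indicator_const _ hEm.compl, smul_eq_mul, mul_one]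
      rw [← h1]
      have hfi : Integrable (fun U => v * Eᶜ.indicator (fun _ => (1 : ℝ)) U) μ :=
        integrable_of_bound ((measurable_const.indicator hEm.compl).const_mul v).aestronglyMeasurable (C := |v|) fun U => by
          by_cases hU : U ∈ Eᶜ
          · rw [Set.indicator_of_mem hU, mul_one]
          · rw [Set.indicator_of_notMem hU, mul_zero, abs_zero]; exact abs_nonneg v
      exact integral_mono hfi hgi hind
    have hcompl : μ.real Eᶜ = 1 - μ.real E := by rw [measureReal_compl hEm, probReal_univ]
    rw [hcompl] at hint
    -- `β ∫ g ≥ β v (1 − p) = (3/2 V − β^{−θ})(1 − p) ≥ 3/2 V − β^{−θ} − (3/2) p`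
    have hβv : β * v = 3 / 2 * V - β ^ (-θ) := by rw [hv]; field_simp
    have hpe : ((6 * (2 * H + 3) ^ 4 : ℕ) : ℝ) * Real.exp (-(β ^ (θ / 5))) = 6 * (2 * (H : ℝ) + 3) ^ 4 * Real.exp (-(β ^ (θ / 5))) := by
      push_cast; ring
    have key : β * v * (1 - μ.real E) ≤ β * ∫ U, g U ∂μ := by
      have := mul_le_mul_of_nonneg_left hint hβ0.le
      linarith [this]
    have hβv0 : 0 ≤ β * v := mul_nonneg hβ0.le hv0
    have h2 : β * v * (1 - p) ≤ β * v * (1 - μ.real E) := mul_le_mul_of_nonneg_left (by linarith) hβv0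
    have h3 : β * v * p ≤ 3 / 2 * p := by
      have : β * v ≤ 3 / 2 := by rw [hβv]; linarith [Real.rpow_nonneg hβ0.le (-θ)]
      exact mul_le_mul_of_nonneg_right this hp0
    rw [hp, hpe] at h3 h2
    generalize hGdef : ∫ U, g U ∂μ = Gint at key ⊢
    nlinarith [key, h2, h3, hβv]
  · -- `v < 0`: the bound is trivial since `∫ g ≥ 0`
    have hG0 : 0 ≤ ∫ U, g U ∂μ := integral_nonneg hg0
    have hβv : β * v = 3 / 2 * V - β ^ (-θ) := by rw [hv]; field_simp
    have : 3 / 2 * V - β ^ (-θ) < 0 := by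
      rw [← hβv]; exact mul_neg_of_pos_of_neg hβ0 (lt_of_not_ge hv0)
    have hexp0 : 0 ≤ 9 * (2 * (H : ℝ) + 3) ^ 4 * Real.exp (-(β ^ (θ / 5))) := by positivity
    nlinarith [mul_nonneg hβ0.le hG0]

/-- **THE ONE-LOOP FLOOR OF THE TORUS PLAQUETTE, `(1,2)`-plane: `β·⟨c_{x;1,2}⟩_{(L+1)⁴,β} ≥ 3/4 − 3β^{−θ}`** for `0 < θ ≤ θ₀`, `β ≥ β₀(θ)`,
eventually in the torus side, every site `x` (§2 plus `V_D(centre) ≥ 1/2 − K/(H−1)⁴`, `pow_four_mul_abs_boxDirProjKernel_centre_sub_half_le`, and the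
exponent bookkeeping `9(2H+3)⁴e^{−β^{θ/5}} ≤ β^{−θ}`, `24Kβ^{−4θ}·16… ≤ β^{−θ}`). [folklore] -/
theorem torus_plaqCost12_ge_threeQuarters :
    ∃ θ₀ : ℝ, 0 < θ₀ ∧ θ₀ ≤ 1 / 100 ∧ ∀ θ : ℝ, 0 < θ → θ ≤ θ₀ → ∃ β₀ : ℝ, ∀ β : ℝ, β₀ ≤ β → ∀ᶠ L : ℕ in atTop, ∀ x : Site 4,
      3 / 4 - 3 * β ^ (-θ) ≤
        β * ∫ U, plaqCostAt (fundamentalRep (Fin 2)) x 1 2 (torusLift (L + 1) U)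
          ∂(wilsonMeasure (d := 4) (L := L + 1) (fundamentalRep (Fin 2)) β) := by
  obtain ⟨θ₀, hθ₀, hθ₀', hA⟩ := torus_plaqCost_ge_oneLoop
  obtain ⟨K, hK0, hK⟩ := pow_four_mul_abs_boxDirProjKernel_centre_sub_half_le
  refine ⟨θ₀, hθ₀, hθ₀', fun θ hθ hθle => ?_⟩
  obtain ⟨β₁, hβ₁⟩ := hA θ hθ hθle
  obtain ⟨b₂, hb₂1, E2⟩ := exists_const_mul_boxSide_pow_mul_exp_neg_le (9 : ℝ) 4 hθ.le (show (0 : ℝ) < θ / 5 by positivity) (-θ)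
  obtain ⟨b₃, -, E3⟩ := exists_const_mul_rpow_le_rpow (24 * K) (a := -(4 * θ)) (b := -θ) (by linarith)
  obtain ⟨b₄, -, E4⟩ := exists_const_mul_rpow_le_rpow (2 : ℝ) (a := 0) (b := θ) hθ
  refine ⟨max (max β₁ b₂) (max b₃ b₄), fun β hβ => ?_⟩
  have hb1 : β₁ ≤ β := ((le_max_left _ _).trans (le_max_left _ _)).trans hβ
  have hb2 : b₂ ≤ β := ((le_max_right _ _).trans (le_max_left _ _)).trans hβ
  have hb3 : b₃ ≤ β := ((le_max_left _ _).trans (le_max_right _ _)).trans hβ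
  have hb4 : b₄ ≤ β := ((le_max_right _ _).trans (le_max_right _ _)).trans hβ
  have hβ1 : (1 : ℝ) ≤ β := hb₂1.trans hb2
  have hβ0 : 0 < β := by linarith
  -- the box: `H = ⌈β^θ⌉ = R + 1` with `R ≥ β^θ/2`
  have h2θ : 2 ≤ β ^ θ := by have h := E4 β hb4; rw [Real.rpow_zero, mul_one] at h; exact h
  have hHge : β ^ θ ≤ (⌈β ^ θ⌉₊ : ℝ) := Nat.le_ceil _
  obtain ⟨R, hR⟩ : ∃ R : ℕ, ⌈β ^ θ⌉₊ = R + 1 :=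
    ⟨⌈β ^ θ⌉₊ - 1, (Nat.sub_add_cancel (by exact_mod_cast (show (1 : ℝ) ≤ ⌈β ^ θ⌉₊ by linarith))).symm⟩
  have hRr : β ^ θ / 2 ≤ (R : ℝ) := by
    have : (⌈β ^ θ⌉₊ : ℝ) = (R : ℝ) + 1 := by rw [hR]; push_cast; ring
    linarith
  have hR0 : 0 < (R : ℝ) := lt_of_lt_of_le (by linarith) hRr
  -- the Dirichlet variance at the centre is `1/2 + O(R⁻⁴)`
  have hV := hK R (1, 2) (by decide)
  have hcen : (boxCentre ⌈β ^ θ⌉₊ : Site 4) = fun _ => (R : ℤ) + 1 := by funext k; simp [boxCentre, hR]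
  filter_upwards [hβ₁ β hb1] with L hL x
  have hmain := hL x
  rw [hcen, hR] at hmain
  dsimp only at hV
  have hVb : |boxDirProjKernel (R + 1) ((fun _ : Fin 4 => (R : ℤ) + 1), 1, 2) ((fun _ : Fin 4 => (R : ℤ) + 1), 1, 2) - 1 / 2| ≤
      16 * K * β ^ (-(4 * θ)) := by
    have hR4 : β ^ (4 * θ) / 16 ≤ (R : ℝ) ^ 4 := by
      have h := pow_le_pow_left₀ (by positivity) hRr 4
      have e : (β ^ θ / 2) ^ 4 = β ^ (4 * θ) / 16 := by
        rw [div_pow, ← Real.rpow_natCast (β ^ θ) 4, ← Real.rpow_mul hβ0.le]; norm_num; ring_nf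
      rw [e] at h; exact h
    have hR4pos : 0 < (R : ℝ) ^ 4 := by positivity
    have h1 : |boxDirProjKernel (R + 1) ((fun _ : Fin 4 => (R : ℤ) + 1), 1, 2) ((fun _ : Fin 4 => (R : ℤ) + 1), 1, 2) - 1 / 2| ≤
        K / (R : ℝ) ^ 4 := by rw [le_div_iff₀ hR4pos, mul_comm]; exact hV
    have h2 : K / (R : ℝ) ^ 4 ≤ K / (β ^ (4 * θ) / 16) := div_le_div_of_nonneg_left hK0 (by positivity) hR4
    have h3 : K / (β ^ (4 * θ) / 16) = 16 * K * β ^ (-(4 * θ)) := by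
      rw [Real.rpow_neg hβ0.le]; field_simp
    linarith [h3 ▸ h2]
  have e2 := E2 β hb2
  have e3 := E3 β hb3
  rw [hR] at e2
  generalize hCdef : boxDirProjKernel (R + 1) ((fun _ : Fin 4 => (R : ℤ) + 1), 1, 2) ((fun _ : Fin 4 => (R : ℤ) + 1), 1, 2) = C
    at hmain hVb
  have hVb' := (abs_le.1 hVb).1
  push_cast at e2 hmain
  linarith

/-- **THE ONE-LOOP FLOOR OF THE TORUS PLAQUETTE, every plane** (hypercubic invariance of the torus Wilson state,
`integral_comp_configPerm_wilsonMeasure`, `configPermZd_torusLift`): for `0 < θ ≤ θ₀`, `β ≥ β₀(θ)`, eventually in the torus side, every site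
`x` and `i ≠ j`: `β·∫ c_{x;i,j} ∘ lift dμ_{(L+1)⁴,β} ≥ 3/4 − 3β^{−θ}`. [folklore] -/
theorem torus_plaqCost_ge_threeQuarters :
    ∃ θ₀ : ℝ, 0 < θ₀ ∧ θ₀ ≤ 1 / 100 ∧ ∀ θ : ℝ, 0 < θ → θ ≤ θ₀ → ∃ β₀ : ℝ, ∀ β : ℝ, β₀ ≤ β → ∀ᶠ L : ℕ in atTop,
      ∀ (x : Site 4) (i j : Fin 4), i ≠ j →
        3 / 4 - 3 * β ^ (-θ) ≤
          β * ∫ U, plaqCostAt (fundamentalRep (Fin 2)) x i j (torusLift (L + 1) U)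
            ∂(wilsonMeasure (d := 4) (L := L + 1) (fundamentalRep (Fin 2)) β) := by
  obtain ⟨θ₀, hθ₀, hθ₀', hA⟩ := torus_plaqCost12_ge_threeQuarters
  refine ⟨θ₀, hθ₀, hθ₀', fun θ hθ hθle => ?_⟩
  obtain ⟨β₀, hβ₀⟩ := hA θ hθ hθle
  refine ⟨β₀, fun β hβ => ?_⟩
  filter_upwards [hβ₀ β hβ] with L hL x i j hij
  obtain ⟨π, h1, h2⟩ := exists_perm_one_two hij
  have hρc : Continuous (fundamentalRep (Fin 2) : Matrix.specialUnitaryGroup (Fin 2) ℂ →* _) := continuous_fundamentalRep (Fin 2)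
  -- `c_{x;i,j} ∘ configPermZd π = c_{π⁻¹x;1,2}`
  have hpt : ∀ W : LGConfig 4 (Matrix.specialUnitaryGroup (Fin 2) ℂ),
      plaqCostAt (fundamentalRep (Fin 2)) x i j (configPermZd π W) = plaqCostAt (fundamentalRep (Fin 2)) (sitePermZd π.symm x) 1 2 W := by
    intro W
    have hi : π.symm i = 1 := by rw [← h1, Equiv.symm_apply_apply]
    have hj : π.symm j = 2 := by rw [← h2, Equiv.symm_apply_apply]
    simp only [plaqCostAt, plaquetteObs_configPermZd, hi, hj]
  have h := hL (sitePermZd π.symm x)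
  have hint : ∫ U, plaqCostAt (fundamentalRep (Fin 2)) x i j (torusLift (L + 1) U) ∂(wilsonMeasure (d := 4) (L := L + 1) (fundamentalRep (Fin 2)) β) =
      ∫ U, plaqCostAt (fundamentalRep (Fin 2)) (sitePermZd π.symm x) 1 2 (torusLift (L + 1) U)
        ∂(wilsonMeasure (d := 4) (L := L + 1) (fundamentalRep (Fin 2)) β) := by
    rw [← integral_comp_configPerm_wilsonMeasure (fundamentalRep (Fin 2)) hρc β π
      (fun U => plaqCostAt (fundamentalRep (Fin 2)) x i j (torusLift (L + 1) U))]
    refine integral_congr_ae (ae_of_all _ fun U => ?_)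
    simp only [← configPermZd_torusLift, hpt]
  rw [hint]
  exact h

/-! ### §3 Crux letters -/

/-- **THE ONE-LOOP FLOOR OF THE TORUS PLAQUETTE DEFICIT (crux letters).**  There is `θ₀ ∈ (0, 1/100]` such that for all `0 < θ ≤ θ₀` there is `β₀`
with: for all `β ≥ β₀`, eventually in `L`, for every plane `q.1 < q.2` and site `x`, on the odd torus `(ℤ/(2L+1))⁴`:
`3/4 − 3β^{−θ} ≤ β · torusE_{β,L}(2 − plane q x)` — the torus plaquette deficit is at least its perturbative one-loop value `3/(4β)` asymptotically,
uniformly in the volume (previous volume-uniform floor: `6/(24β+3)`, `ThermalFloor.torusE_plane_le`). [folklore] -/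
theorem torusE_two_sub_plane_ge_threeQuarters :
    ∃ θ₀ : ℝ, 0 < θ₀ ∧ θ₀ ≤ 1 / 100 ∧ ∀ θ : ℝ, 0 < θ → θ ≤ θ₀ → ∃ β₀ : ℝ, ∀ β : ℝ, β₀ ≤ β → ∀ᶠ L : ℕ in atTop,
      ∀ (q : Fin 4 × Fin 4) (x : Fin 4 → ℤ), q.1 < q.2 →
        3 / 4 - 3 * β ^ (-θ) ≤
          β * torusE (Matrix.specialUnitaryGroup (Fin 2) ℂ) (fundamentalLatticeRep 2) β L
            (fun U => 2 - plane (Matrix.specialUnitaryGroup (Fin 2) ℂ) (fundamentalLatticeRep 2) q x U) := by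
  obtain ⟨θ₀, hθ₀, hθ₀', hA⟩ := torus_plaqCost_ge_threeQuarters
  refine ⟨θ₀, hθ₀, hθ₀', fun θ hθ hθle => ?_⟩
  obtain ⟨β₀, hβ₀⟩ := hA θ hθ hθle
  refine ⟨β₀, fun β hβ => ?_⟩
  obtain ⟨N, hN⟩ := Filter.eventually_atTop.1 (hβ₀ β hβ)
  refine Filter.eventually_atTop.2 ⟨N, fun L hL q x hq => ?_⟩
  have h := hN (2 * L) (by omega) x q.1 q.2 (ne_of_lt hq)
  unfold torusE
  simp_rw [two_sub_plane_eq_plaqCostAt]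
  exact h

end Summit.QuantumFields.YangMills.Cruxes.UVSeamRec.ClassicalResponse.ColdWall

end
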